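import Mathlib
import Literature.Analysis.FluidPDE.HarmonicProbe
import Literature.Analysis.FluidPDE.ConvolutionLaplacian
import Literature.Analysis.FunctionSpaces.Mollification
import HarnessLib

/-!
# Crux `EulerZoomLiouville.PowerGaugeEulerLiouville` (stmt-NavierStokesRegularity-19832): t60-ΠLOG piece S5a — LIOUVILLE MODULO CONSTANTS, THE TOOL

Width/portrait piece (`--supports stmt-NavierStokesRegularity-19832 --as helper`; LEAD 19832 ns-typeII-p2 g16 KEY S58c-5, 12:31:27Z) of nsreg-p2's
instrument t60-ΠLOG (`r58/Sketch58c.lean` c6fe466b7b48535d, namespace `NsregP2.R58c`, piece S5 `LiouvilleModConst`).  This file is the harmonic-analysis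
TOOL behind S5, free of any profile: **a locally integrable, distributionally harmonic function on `ℝ³` whose mean oscillation on balls is `o(R⁴)` is
a.e. constant.**  Precisely (`ae_const_of_weaklyHarmonic_of_oscillation`): if `h ∈ L¹_loc(ℝ³)`, `∫ h Δψ = 0` for every `ψ ∈ C^∞_c`, and for every `R ≥ 1`
there is a constant `c_R` with `∫_{B_R} |h − c_R| ≤ G(R)` where `G(R)/R⁴ → 0`, then `h = κ` a.e. for some `κ ∈ ℝ`.

Proof (Weyl + the mean-value gradient estimate, dilated): for a fixed bump `φ` the mollification `H = φ̃ ⋆ h` is harmonic on `ℝ³`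
(`ConvolutionLaplacian.harmonicOnNhd_convolution`); the gradient formula `∇H(y)·a = ∫ ∇χ_R(z)·a · (H(y − z) − c) dz` with the unit-mass radial probe
`χ_R` (`HarmonicProbe.fderiv_harmonic_eq_integral_probeBump` applied to `H − c`, `‖∇χ_R‖ ≤ C/(m R³·R)`) gives
`|∇H(y)·a| ≤ C ‖a‖ R⁻⁴ ∫_{B̄(0,2R)} |H(y − z) − c| dz` (`abs_fderiv_apply_le_of_harmonic_oscillation`); on that ball `H − c = φ̃ ⋆ (𝟙_{B_S}(h − c))` once
`‖y‖ + 2R + r_φ < S` (`normed_convolution_sub_const_eq`), so Young's inequality with the unit-mass kernel (`FunctionSpaces.eLpNorm_normed_convolution_le`)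
bounds the integral by `∫_{B_S} |h − c_S| ≤ G(S)`; with `R = S/3`, `S → ∞`: `∇H ≡ 0`, `H` is constant; finally bumps `→ δ`
(`ConvolutionLaplacian.ae_eq_const_of_forall_convolution_normed_const`).

HONEST FRAMING: a textbook Liouville-type lemma (portrait instrument tool); nothing here bears on the crux E (19832 OPEN) or on NS regularity; not E.
[cite: GilbargTrudinger2001, Thm 2.10; Evans2010, App. C.4 Thm. 7] [nsreg-p2 R58 S58c-5; folklore]
-/

noncomputable section

set_option linter.dupNamespace false

open MeasureTheory Set Filter Topology Metric Function InnerProductSpace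
open scoped NNReal ENNReal Topology Convolution ContDiff Laplacian

namespace Summit.NavierStokesRegularity.NavierStokesRegularity.Theorems.PowerGaugeEulerLiouville.PressureSeam

open Literature.Analysis Literature.Analysis.FluidPDE Literature.Analysis.FunctionSpaces ContinuousLinearMap

/-- **The mean-value gradient estimate against the oscillation** (Gilbarg–Trudinger (2.31), dilated, modulo constants): for `η` harmonic on `ℝ³`,
`R > 0`, any constant `c` and any direction `a`,
`|∇η(y)·a| ≤ (m R³)⁻¹ R⁻¹ C_θ ‖a‖ ∫_{B̄(0,2R)} |η(y − z) − c| dz`, where `χ_R = (m R³)⁻¹ θ(·/R)` is the unit-mass radial probe and `C_θ = sup ‖∇θ‖`.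
[cite: GilbargTrudinger2001, Thm 2.10] -/
theorem abs_fderiv_apply_le_of_harmonic_oscillation {η : EuclideanSpace ℝ (Fin 3) → ℝ} (hη : HarmonicOnNhd η univ)
    {Cθ : ℝ} (hCθ : ∀ x : EuclideanSpace ℝ (Fin 3), ‖fderiv ℝ baseBump x‖ ≤ Cθ) {R : ℝ} (hR : 0 < R)
    (y a : EuclideanSpace ℝ (Fin 3)) (c : ℝ) :
    |fderiv ℝ η y a| ≤ (baseBumpMass (EuclideanSpace ℝ (Fin 3)) * R ^ 3)⁻¹ * R⁻¹ * Cθ * ‖a‖ *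
      ∫ z in closedBall (0 : EuclideanSpace ℝ (Fin 3)) (2 * R), |η (y - z) - c| := by
  have hd : Module.finrank ℝ (EuclideanSpace ℝ (Fin 3)) = 3 := by simp
  set m := baseBumpMass (EuclideanSpace ℝ (Fin 3)) with hm
  have hm0 : 0 < m := baseBumpMass_pos
  have hC0 : 0 ≤ Cθ := (norm_nonneg _).trans (hCθ 0)
  -- pass to `η - c`, harmonic with the same gradient
  set η' : EuclideanSpace ℝ (Fin 3) → ℝ := fun x => η x - c with hη'def
  have hη' : HarmonicOnNhd η' univ := hη.sub (harmonicOnNhd_const c)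
  have hη2 : ContDiff ℝ 2 η := contDiff_two_of_harmonicOnNhd_univ hη
  have hfd : fderiv ℝ η y = fderiv ℝ η' y := by
    rw [hη'def, fderiv_sub_const]
  -- the uniform bound on `Dχ_R`
  set k := (m * R ^ 3)⁻¹ * R⁻¹ * Cθ with hk
  have hk0 : 0 ≤ k := by positivity
  have hDχ : ∀ z : EuclideanSpace ℝ (Fin 3), ‖fderiv ℝ (probeBump R) z‖ ≤ k := fun z => by
    have h := norm_fderiv_probeBump_le hR hCθ z
    rwa [hd] at h
  rw [hfd, fderiv_harmonic_eq_integral_probeBump hη' hR y a]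
  -- domination by the indicator of the closed ball of radius `2R`
  set g : EuclideanSpace ℝ (Fin 3) → ℝ := fun z =>
    (closedBall (0 : EuclideanSpace ℝ (Fin 3)) (2 * R)).indicator (fun z => k * ‖a‖ * |η' (y - z)|) z with hg
  have hdom : ∀ z, ‖fderiv ℝ (probeBump R) z a * η' (y - z)‖ ≤ g z := by
    intro z
    simp only [hg]
    by_cases hz : z ∈ closedBall (0 : EuclideanSpace ℝ (Fin 3)) (2 * R)
    · rw [indicator_of_mem hz, norm_mul, Real.norm_eq_abs, Real.norm_eq_abs]
      have h1 : |fderiv ℝ (probeBump R) z a| ≤ k * ‖a‖ := by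
        rw [← Real.norm_eq_abs]
        exact (ContinuousLinearMap.le_opNorm _ _).trans (mul_le_mul_of_nonneg_right (hDχ z) (norm_nonneg _))
      exact mul_le_mul_of_nonneg_right h1 (abs_nonneg _)
    · rw [indicator_of_notMem hz]
      have hz' : z ∉ tsupport (probeBump (E := EuclideanSpace ℝ (Fin 3)) R) := fun h => hz (tsupport_probeBump_subset hR h)
      rw [fderiv_of_notMem_tsupport ℝ hz']
      simp
  have hη'c : Continuous fun z => |η' (y - z)| :=
    ((hη2.continuous.sub continuous_const).comp (continuous_const.sub continuous_id)).abs
  have hgi : Integrable g := by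
    rw [hg, integrable_indicator_iff measurableSet_closedBall]
    exact ((continuous_const.mul hη'c).continuousOn).integrableOn_compact (isCompact_closedBall _ _)
  have hint := norm_integral_le_of_norm_le hgi (Eventually.of_forall hdom)
  rw [Real.norm_eq_abs] at hint
  refine hint.trans_eq ?_
  rw [hg, integral_indicator measurableSet_closedBall, integral_const_mul]

/-- **Localising the mollification modulo a constant**: if `B̄(x, r_φ) ⊆ U` then `(φ̃ ⋆ h)(x) − c = (φ̃ ⋆ 𝟙_U (h − c))(x)` (the kernel
`φ̃ = φ.normed` has unit mass and is supported in `B(0, r_φ)`). [cite: Evans2010, App. C.4 Thm. 7] -/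
theorem normed_convolution_sub_const_eq (φ : ContDiffBump (0 : EuclideanSpace ℝ (Fin 3)))
    {h : EuclideanSpace ℝ (Fin 3) → ℝ} (hh : LocallyIntegrable h volume)
    {U : Set (EuclideanSpace ℝ (Fin 3))} {x : EuclideanSpace ℝ (Fin 3)} (hU : closedBall x φ.rOut ⊆ U) (c : ℝ) :
    (φ.normed volume ⋆ h) x - c = (φ.normed volume ⋆ U.indicator (fun w => h w - c)) x := by
  rw [convolution_lsmul, convolution_lsmul]
  have hint : Integrable (fun t => φ.normed volume t • h (x - t)) volume :=
    φ.hasCompactSupport_normed.convolutionExists_left (lsmul ℝ ℝ) φ.continuous_normed hh x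
  have hpt : (fun t => φ.normed volume t • U.indicator (fun w => h w - c) (x - t)) =
      fun t => φ.normed volume t • h (x - t) - φ.normed volume t • c := by
    funext t
    by_cases ht : φ.normed volume t = 0
    · simp [ht]
    · have ht' : t ∈ Function.support (φ.normed volume) := ht
      rw [φ.support_normed_eq, mem_ball_zero_iff] at ht'
      have hxt : x - t ∈ U := hU (by
        rw [mem_closedBall, dist_eq_norm, sub_sub_cancel_left, norm_neg]
        exact ht'.le)
      rw [indicator_of_mem hxt, smul_sub]
  rw [hpt, integral_sub hint (φ.integrable_normed.smul_const c), integral_smul_const, φ.integral_normed, one_smul]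

/-- **Young's inequality on a ball, modulo constants**: if `‖y‖ + 2R + r_φ < S` then
`∫_{B̄(0,2R)} |(φ̃ ⋆ h)(y − z) − c| dz ≤ ∫_{B_S} |h − c|` — on that ball `φ̃ ⋆ h − c = φ̃ ⋆ 𝟙_{B_S}(h − c)` (`normed_convolution_sub_const_eq`) and
`‖φ̃ ⋆ g‖_{L¹} ≤ ‖g‖_{L¹}` for the unit-mass kernel (`FunctionSpaces.eLpNorm_normed_convolution_le`). [cite: Evans2010, App. C.4 Thm. 7] -/
theorem setIntegral_abs_normed_convolution_sub_const_le (φ : ContDiffBump (0 : EuclideanSpace ℝ (Fin 3)))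
    {h : EuclideanSpace ℝ (Fin 3) → ℝ} (hh : LocallyIntegrable h volume) {R S : ℝ} {y : EuclideanSpace ℝ (Fin 3)}
    (hS : ‖y‖ + 2 * R + φ.rOut < S) (c : ℝ) :
    ∫ z in closedBall (0 : EuclideanSpace ℝ (Fin 3)) (2 * R), |(φ.normed volume ⋆ h) (y - z) - c| ≤
      ∫ w in ball (0 : EuclideanSpace ℝ (Fin 3)) S, |h w - c| := by
  set g : EuclideanSpace ℝ (Fin 3) → ℝ := (ball (0 : EuclideanSpace ℝ (Fin 3)) S).indicator fun w => h w - c with hg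
  set F : EuclideanSpace ℝ (Fin 3) → ℝ := φ.normed volume ⋆ g with hF
  have hgi : Integrable g volume := by
    rw [hg, integrable_indicator_iff measurableSet_ball]
    exact ((hh.integrableOn_isCompact (isCompact_closedBall (0 : EuclideanSpace ℝ (Fin 3)) S)).mono_set
      ball_subset_closedBall).sub (integrableOn_const measure_ball_lt_top.ne)
  have hgm : AEStronglyMeasurable g volume := hgi.aestronglyMeasurable
  -- on the closed ball the integrand is `|F(y - z)|`
  have hpt : ∀ z ∈ closedBall (0 : EuclideanSpace ℝ (Fin 3)) (2 * R), |(φ.normed volume ⋆ h) (y - z) - c| = ‖F (y - z)‖ := by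
    intro z hz
    rw [mem_closedBall_zero_iff] at hz
    rw [Real.norm_eq_abs, hF, ← normed_convolution_sub_const_eq φ hh _ c]
    intro w hw
    rw [mem_closedBall, dist_eq_norm] at hw
    rw [mem_ball_zero_iff]
    calc ‖w‖ = ‖(w - (y - z)) + (y - z)‖ := by rw [sub_add_cancel]
      _ ≤ ‖w - (y - z)‖ + ‖y - z‖ := norm_add_le _ _
      _ ≤ ‖w - (y - z)‖ + (‖y‖ + ‖z‖) := by gcongr; exact norm_sub_le y z
      _ < S := by linarith
  rw [setIntegral_congr_fun measurableSet_closedBall hpt]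
  have hFc : Continuous F :=
    (φ.hasCompactSupport_normed.contDiff_convolution_left (lsmul ℝ ℝ) (φ.contDiff_normed (n := 1))
      hgi.locallyIntegrable).continuous
  have hFm : AEStronglyMeasurable (fun z => F (y - z))
      (volume.restrict (closedBall (0 : EuclideanSpace ℝ (Fin 3)) (2 * R))) :=
    (hFc.comp (continuous_const.sub continuous_id)).aestronglyMeasurable
  rw [integral_norm_eq_lintegral_enorm hFm]
  have hfin : (∫⁻ w, ‖g w‖ₑ) < ⊤ := hasFiniteIntegral_iff_enorm.mp hgi.hasFiniteIntegral
  have hle : ∫⁻ z in closedBall (0 : EuclideanSpace ℝ (Fin 3)) (2 * R), ‖F (y - z)‖ₑ ≤ ∫⁻ w, ‖g w‖ₑ :=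
    calc ∫⁻ z in closedBall (0 : EuclideanSpace ℝ (Fin 3)) (2 * R), ‖F (y - z)‖ₑ
        ≤ ∫⁻ z, ‖F (y - z)‖ₑ := setLIntegral_le_lintegral _ _
      _ = ∫⁻ x, ‖F x‖ₑ := lintegral_sub_left_eq_self (fun x => ‖F x‖ₑ) y
      _ = eLpNorm F 1 volume := eLpNorm_one_eq_lintegral_enorm.symm
      _ ≤ eLpNorm g 1 volume := eLpNorm_normed_convolution_le φ hgm le_rfl
      _ = ∫⁻ w, ‖g w‖ₑ := eLpNorm_one_eq_lintegral_enorm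
  calc (∫⁻ z in closedBall (0 : EuclideanSpace ℝ (Fin 3)) (2 * R), ‖F (y - z)‖ₑ).toReal
      ≤ (∫⁻ w, ‖g w‖ₑ).toReal := ENNReal.toReal_mono hfin.ne hle
    _ = ∫ w, ‖g w‖ := (integral_norm_eq_lintegral_enorm hgm).symm
    _ = ∫ w in ball (0 : EuclideanSpace ℝ (Fin 3)) S, |h w - c| := by
        have hnorm : (fun w => ‖g w‖) = (ball (0 : EuclideanSpace ℝ (Fin 3)) S).indicator fun w => |h w - c| := by
          funext w
          rw [hg, norm_indicator_eq_indicator_norm]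
          simp only [Real.norm_eq_abs]
        rw [hnorm, integral_indicator measurableSet_ball]

/-- ★ **S5a — Liouville modulo constants for distributionally harmonic functions with `o(R⁴)` mean oscillation**: if `h ∈ L¹_loc(ℝ³)` satisfies
`∫ h Δψ = 0` for every smooth compactly supported `ψ`, and for every `R ≥ 1` there is a constant `c_R` with `∫_{B_R} |h − c_R| ≤ G(R)` where
`G(R)/R⁴ → 0`, then `h` is a.e. equal to a constant.  (Weyl: every mollification `φ̃ ⋆ h` is harmonic; the dilated mean-value gradient estimate modulo
constants + Young on balls give `|∇(φ̃ ⋆ h)(y)·a| ≤ 81 C ‖a‖ G(S)/S⁴ → 0`, so each mollification is constant; bumps `→ δ`.)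
[cite: GilbargTrudinger2001, Thm 2.10; Evans2010, App. C.4 Thm. 7] -/
theorem ae_const_of_weaklyHarmonic_of_oscillation {h : EuclideanSpace ℝ (Fin 3) → ℝ} (hh : LocallyIntegrable h volume)
    (hharm : ∀ ψ : EuclideanSpace ℝ (Fin 3) → ℝ, ContDiff ℝ (⊤ : ℕ∞) ψ → HasCompactSupport ψ → ∫ x, h x * (Δ ψ) x = 0)
    {G : ℝ → ℝ} (hG : ∀ R : ℝ, 1 ≤ R → ∃ c : ℝ, ∫ y in ball (0 : EuclideanSpace ℝ (Fin 3)) R, |h y - c| ≤ G R)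
    (hGlim : Tendsto (fun R => G R / R ^ 4) atTop (𝓝 0)) :
    ∃ κ : ℝ, ∀ᵐ x ∂(volume : Measure (EuclideanSpace ℝ (Fin 3))), h x = κ := by
  refine ConvolutionLaplacian.ae_eq_const_of_forall_convolution_normed_const hh fun φ _ => ?_
  set H : EuclideanSpace ℝ (Fin 3) → ℝ := φ.normed volume ⋆ h with hH
  have hHharm : HarmonicOnNhd H univ :=
    ConvolutionLaplacian.harmonicOnNhd_convolution hh hharm φ.contDiff_normed φ.hasCompactSupport_normed
  have hHd : Differentiable ℝ H :=
    (φ.hasCompactSupport_normed.contDiff_convolution_left (lsmul ℝ ℝ) (φ.contDiff_normed (n := 1)) hh).differentiable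
      (by norm_num)
  obtain ⟨Cθ, hCθ⟩ := (exists_bound_baseBump_derivs (E := EuclideanSpace ℝ (Fin 3))).1
  have hC0 : 0 ≤ Cθ := (norm_nonneg _).trans (hCθ 0)
  set m := baseBumpMass (EuclideanSpace ℝ (Fin 3)) with hm
  have hm0 : 0 < m := baseBumpMass_pos
  have key : ∀ y a : EuclideanSpace ℝ (Fin 3), fderiv ℝ H y a = 0 := by
    intro y a
    set K : ℝ := 81 * (m⁻¹ * Cθ * ‖a‖) with hK
    have hev : ∀ᶠ S in atTop, |fderiv ℝ H y a| ≤ K * (G S / S ^ 4) := by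
      filter_upwards [eventually_gt_atTop (3 * (‖y‖ + φ.rOut) + 3), eventually_ge_atTop (1 : ℝ)] with S hS hS1
      have hS0 : 0 < S := by linarith
      set R : ℝ := S / 3 with hR
      have hR0 : 0 < R := by positivity
      have hRS : ‖y‖ + 2 * R + φ.rOut < S := by rw [hR]; linarith
      obtain ⟨c, hc⟩ := hG S hS1
      have h1 := abs_fderiv_apply_le_of_harmonic_oscillation hHharm hCθ hR0 y a c
      have h2 := setIntegral_abs_normed_convolution_sub_const_le φ hh hRS c
      have h3 : (m * R ^ 3)⁻¹ * R⁻¹ * Cθ * ‖a‖ = K / S ^ 4 := by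
        rw [hK, hR]
        field_simp
        ring
      calc |fderiv ℝ H y a|
          ≤ (m * R ^ 3)⁻¹ * R⁻¹ * Cθ * ‖a‖ *
              ∫ z in closedBall (0 : EuclideanSpace ℝ (Fin 3)) (2 * R), |H (y - z) - c| := h1
        _ ≤ (m * R ^ 3)⁻¹ * R⁻¹ * Cθ * ‖a‖ * G S := mul_le_mul_of_nonneg_left (h2.trans hc) (by positivity)
        _ = K * (G S / S ^ 4) := by rw [h3]; ring
    have hlim : Tendsto (fun S => K * (G S / S ^ 4)) atTop (𝓝 0) := by
      simpa using hGlim.const_mul K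
    have hle : |fderiv ℝ H y a| ≤ 0 := ge_of_tendsto hlim hev
    exact abs_nonpos_iff.1 hle
  have hfd0 : ∀ y, fderiv ℝ H y = 0 := fun y => by
    ext a
    exact key y a
  exact ⟨H 0, fun x => is_const_of_fderiv_eq_zero hHd hfd0 x 0⟩

end Summit.NavierStokesRegularity.NavierStokesRegularity.Theorems.PowerGaugeEulerLiouville.PressureSeam

end
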